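import Summits.CriticalPhenomena.PercolationContinuityZ3.Theorems.Transplant.FKConnectivityAllQForestTreeLevel
import HarnessLib

/-!
# CONJECTURE TSD (tight star-deletion monotonicity, NOT asserted) and its kernel arrow: TSD ⇒ (♣)⁰ at the LAMAN LEVEL

Support file (`--supports stmt-CriticalPhenomena-4575`), FK sub-lane `prim-bschramm-fk-1` (generation 29) of the post-continuity
programme; builds on p205010 (kernel theorem, internal audit signed; external expert review pending).  One definition pair (a counting
predicate `…On V` and its `@[conjecture]` `…Pos`, NOT asserted), one arrow; no named facts, no sorries; standard axioms.

With the TREE LEVEL in the kernel (`adjForestNoSq_fibre_of_tight`: the node on every tight fibre), the next rung of the square-free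
adjacent forest Rayleigh node (♣)⁰ is the LAMAN LEVEL `2|S| = |M| + 2|u₀| + 3` (valid colourings = (spanning tree, 2-forest) pairs; the
densest layer of the `(2,3)`-sparse minimal-counterexample universe).  Memo bschramm/FROM-fk-1-g29-TREE-LEVEL.md §4: for a Laman-level
fibre `N` and a non-neighbour `s` of the hub, `margin(N) = margin(N + os) − a_s` with `a_s = Σ_{2-forest class joins o,s} χ_eχ_f`, so the
Laman level follows from **TSD**: *on a TIGHT fibre, deleting a free star pair `os` (`s ∉ {v, y}`) does not decrease the margin*
(`good(M ∖ os) + bad(M) ≥ good(M) + bad(M ∖ os)`; equivalently `a_s ≤ 0`, equivalently g25's hub-pair type "both classes join `o, s`"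
has nonnegative margin at Laman level).  EVIDENCE (exact enumeration, seat numerics stardel.py / stardel_pinned.py / laman_as.py /
joinpart.py): 0 failures in 7,140 (tight simple graphs, n ≤ 7) + 2,796 (tight fibres with pinned pairs) + 5,225 + 6,412 (Laman-level
forms) tests; kit j227161 (n = 8).  CONTROLS: the same monotonicity is false one level down (300/5,487) and for non-star pairs
(2,916/22,745).  Here: **`TightStarDeletionMonoOn V`** / `@[conjecture] TightStarDeletionMonoPos` and the arrow
**`adjForestNoSq_fibre_of_laman_of_tsd`**: TSD on `V` ⇒ the node's inequality on every fibre inside `S` with `2|S| ≤ |N| + 2|u₀| + 3`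
whose hub has a non-neighbour `s ∈ S ∖ {v, y}` (the pair `os` outside the fibre) — by TSD at `(N ∪ {os}, u₀)` and the tree level there.
[cite: CibulkaHladkyLaCroixWagner2008, Thm. 1 (p. 2)] [cite: SempleWelsh2008, Conj. 1.1 (p. 2); Thm. 4.2 (p. 11)] [cite: Linusson2011, Prop. 2.6]
-/

noncomputable section

namespace Summit.CriticalPhenomena.PercolationContinuityZ3.Theorems
namespace FK

open MeasureTheory Set Literature.Probability.LatticeModels Literature.Probability.Percolation
open scoped Classical symmDiff

variable {V : Type*} [Fintype V]

/-- **Tight star-deletion monotonicity on the vertex type `V`** (TSD; NOT asserted): on every TIGHT fibre `(M, u₀)` inside `S`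
(`2|S| = |M| + 2|u₀| + 2`), for every hub `o`, adjacent pairs `e = ov`, `f = oy` and every further free star pair `g = os` (`s ∉ {v, y}`),
`good(M ∖ {g}) + bad(M) ≥ good(M) + bad(M ∖ {g})`, i.e. `margin(M ∖ {g}, u₀) ≥ margin(M, u₀)`.
[cite: SempleWelsh2008, Conj. 1.1 (p. 2)] [cite: CibulkaHladkyLaCroixWagner2008, Thm. 1 (p. 2)] -/
def TightStarDeletionMonoOn (V : Type*) [Fintype V] : Prop :=
  ∀ (M u₀ : BondConfig V) (S : Finset V) (o v y s : V), Disjoint u₀ M → v ≠ y → s ≠ v → s ≠ y → o ≠ s →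
    (∀ g ∈ M ∪ u₀, ∀ w ∈ g, w ∈ S) → 2 * S.card = M.ncard + 2 * u₀.ncard + 2 → s(o, s) ∈ M →
    fibreCount M u₀ (forestEv V ∩ {ω | s(o, v) ∈ ω}) (forestEv V ∩ {ω | s(o, y) ∈ ω}) +
        fibreCount (M \ {s(o, s)}) u₀ (forestEv V ∩ {ω | s(o, v) ∈ ω ∧ s(o, y) ∈ ω}) (forestEv V) ≤
      fibreCount (M \ {s(o, s)}) u₀ (forestEv V ∩ {ω | s(o, v) ∈ ω}) (forestEv V ∩ {ω | s(o, y) ∈ ω}) +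
        fibreCount M u₀ (forestEv V ∩ {ω | s(o, v) ∈ ω ∧ s(o, y) ∈ ω}) (forestEv V)

/-- **TSD on every finite vertex type.**  CONJECTURE-SHAPED, NOT asserted (evidence in the module docstring).
[cite: SempleWelsh2008, Conj. 1.1 (p. 2)] -/
@[conjecture] def TightStarDeletionMonoPos : Prop := ∀ n : ℕ, TightStarDeletionMonoOn (Fin n)

/-- **TSD ⇒ the node at the Laman level.**  If `(N, u₀)` lies inside `S` with `2|S| ≤ |N| + 2|u₀| + 3` and the hub `o ∈ S` has a
non-neighbour `s ∈ S ∖ {v, y}` (`os ∉ N ∪ u₀`), then TSD on `V` gives `bad ≤ good` on `(N, u₀)`: the fibre `(N ∪ {os}, u₀)` is tight (or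
over-tight), the tree level holds there (`adjForestNoSq_fibre_of_tight`), and TSD transfers it down.
[cite: CibulkaHladkyLaCroixWagner2008, Thm. 1 (p. 2)] [cite: SempleWelsh2008, Conj. 1.1 (p. 2)] [cite: Linusson2011, Prop. 2.6] -/
theorem adjForestNoSq_fibre_of_laman_of_tsd (hTSD : TightStarDeletionMonoOn V) {N u₀ : BondConfig V} {o v y s : V} (S : Finset V)
    (hd : Disjoint u₀ N) (hvy : v ≠ y) (hsv : s ≠ v) (hsy : s ≠ y) (hos : o ≠ s) (hS : ∀ g ∈ N ∪ u₀, ∀ w ∈ g, w ∈ S)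
    (hoS : o ∈ S) (hsS : s ∈ S) (hl : 2 * S.card ≤ N.ncard + 2 * u₀.ncard + 3) (hN : s(o, s) ∉ N) (hu : s(o, s) ∉ u₀) :
    fibreCount N u₀ (forestEv V ∩ {ω | s(o, v) ∈ ω ∧ s(o, y) ∈ ω}) (forestEv V) ≤
      fibreCount N u₀ (forestEv V ∩ {ω | s(o, v) ∈ ω}) (forestEv V ∩ {ω | s(o, y) ∈ ω}) := by
  have hd' : Disjoint u₀ (insert s(o, s) N) := Set.disjoint_insert_right.2 ⟨hu, hd⟩
  have hS' : ∀ g ∈ insert s(o, s) N ∪ u₀, ∀ w ∈ g, w ∈ S := by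
    intro g hg w hw
    rcases hg with hg | hg
    · rcases mem_insert_iff.1 hg with rfl | hg
      · rcases Sym2.mem_iff.1 hw with rfl | rfl
        · exact hoS
        · exact hsS
      · exact hS g (Or.inl hg) w hw
    · exact hS g (Or.inr hg) w hw
  have hcard : (insert s(o, s) N).ncard = N.ncard + 1 := ncard_insert_of_notMem hN (toFinite _)
  have htree := adjForestNoSq_fibre_of_tight (o := o) S hd' hvy hS' (by rw [hcard]; omega)
  have hback : insert s(o, s) N \ {s(o, s)} = N := by
    rw [← union_singleton, union_sdiff_right, sdiff_eq_left.2 (Set.disjoint_singleton_right.2 hN)]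
  -- either the enlarged fibre is exactly tight (TSD applies) or over-tight (no valid colouring there, and `N` is tight: tree level)
  rcases Nat.lt_or_ge (2 * S.card) (N.ncard + 2 * u₀.ncard + 3) with hlt | hge
  · exact adjForestNoSq_fibre_of_tight (o := o) S hd hvy hS (by omega)
  · have heq : 2 * S.card = (insert s(o, s) N).ncard + 2 * u₀.ncard + 2 := by rw [hcard]; omega
    have key := hTSD (insert s(o, s) N) u₀ S o v y s hd' hvy hsv hsy hos hS' heq (mem_insert _ _)
    rw [hback] at key
    omega

end FK
end Summit.CriticalPhenomena.PercolationContinuityZ3.Theorems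

end
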